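import Summits.CriticalPhenomena.PercolationContinuityZ3.Theorems.PercNearOneGluingNoHeavyPcintClosingCountKernel
import HarnessLib

/-!
# CriticalPhenomena/PercolationContinuityZ3 — Theorems/PercNearOneGluingNoHeavyPcintClosingCountKernelZ2.lean: the polygon counts of `ℤ²` by kernel — `closingCount 2 6 = 24`, `closingCount 2 8 = 112`

Lane prim-pcint, STRUCTURE rule (densities `f_τ(ℤ²)` of the `d = 2` row of the factor table).  `closingCount_eq_cntP` + the first-letter
reduction `cntP_empty_succ` (…ClosingCountKernel), evaluated by `decide +kernel` on the square lattice: **`closingCount 2 6 = 24`**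
(`2·6·p_6`, `p_6(ℤ²) = 2`), **`closingCount 2 8 = 112`** (`p_8(ℤ²) = 7`; OEIS A002931) — `4⁴` and `4⁶` words after the first
letter (`closingCount 2 10 = 560` over `4⁸` words already exceeds the default heartbeat budget and is not attempted here).

HONEST FRAMING: kernel evaluations; nothing here is used by a certified `p_c` cell.  Written by prim-pcint-2 gen 17
(prover-prim-pcint-2-g17-0), 2026-08-25.
-/

namespace Summit.CriticalPhenomena.PercolationContinuityZ3.Theorems.Pcint

open Literature.Probability.Percolation Literature.Probability.LatticeModels

/-- **`2·6·p_6(ℤ²) = 24`**. [this work] -/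
theorem closingCount_six_zd2 : MemoryTail.closingCount 2 6 = 24 := by
  rw [closingCount_eq_cntP (by norm_num), show (6 : ℕ) - 1 = 4 + 1 from rfl, cntP_empty_succ]
  have h : cntP (mstep 6) (HasAge 5) ({(-stepVec ((0 : Fin 2), true), 1)} : MState 2) 4 = 6 := by
    decide +kernel
  rw [h]

/-- **`2·8·p_8(ℤ²) = 112`**. [this work] -/
theorem closingCount_eight_zd2 : MemoryTail.closingCount 2 8 = 112 := by
  rw [closingCount_eq_cntP (by norm_num), show (8 : ℕ) - 1 = 6 + 1 from rfl, cntP_empty_succ]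
  have h : cntP (mstep 8) (HasAge 7) ({(-stepVec ((0 : Fin 2), true), 1)} : MState 2) 6 = 28 := by
    decide +kernel
  rw [h]

end Summit.CriticalPhenomena.PercolationContinuityZ3.Theorems.Pcint
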